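import Literature.Analysis.FluidPDE.PineauVicolOneSlice
import Literature.Analysis.FluidPDE.PineauVicolOneSliceRegularityHolds

/-!
# Crux `SymmetricScarExists` (stmt-NavierStokesRegularity-11718), line `logtime-bernoulli-certificate`: STUB 7

The registered stub `stub_pineauVicolOneSlice` of the line's skeleton
(`Cruxes/SymmetricScarExists/Lines/logtime-bernoulli-certificate.lean`) asks for the named fact
`Literature.Analysis.FluidPDE.pineauVicol2026_oneSlice_regularity` (Pineau–Vicol 2026, Thm. 1.9:
Type-I solutions approximately self-similar on one time slice are regular at the apex).  The fact is
DISCHARGED in the tree (`pineauVicol2026_oneSlice_regularity_holds`,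
`Literature/Analysis/FluidPDE/PineauVicolOneSliceRegularityHolds.lean`), so the stub is closed by
citing it.  Helper file for the crux item (lands `--supports stmt-NavierStokesRegularity-11718`).
-/

namespace Summit.NavierStokesRegularity.NavierStokesRegularity.Theorems.SymmetricScarExists.LogtimeBernoulli

/-- **STUB 7 of line `logtime-bernoulli-certificate`**: Pineau–Vicol's one-slice regularity theorem
(arXiv:2607.09619, Thm. 1.9) as the tree's named fact, discharged by
`Literature.Analysis.FluidPDE.pineauVicol2026_oneSlice_regularity_holds`. -/
theorem stub_pineauVicolOneSlice :
    Literature.Analysis.FluidPDE.pineauVicol2026_oneSlice_regularity :=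
  Literature.Analysis.FluidPDE.pineauVicol2026_oneSlice_regularity_holds

end Summit.NavierStokesRegularity.NavierStokesRegularity.Theorems.SymmetricScarExists.LogtimeBernoulli
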